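import Literature.MathematicalPhysics.QuantumFieldTheory.Balaban1983to89.B9Eq315QFlatNorm
import Literature.MathematicalPhysics.QuantumFieldTheory.Balaban1983to89.B7Prop5GeneralLevels

/-!
# `Balaban1983to89.B9Eq315QLipschitzL2` — T. Bałaban, *Propagators for lattice gauge theories in a background field*, Commun. Math. Phys. **99**
# (1985) 389–434 [Balaban1985BackgroundPropagators] (3.15) p. 393, (3.78)–(3.79) p. 406 and p. 407 («semi-local operator»), with [Balaban1985Averaging]
# (124)–(126) p. 36 and p. 24 ∕ p. 31 (LOCALITY of the averages): **THE ONE-STEP `δ_Q`-LETTER IN THE `L²` CURRENCY WITHOUT THE VOLUME —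
# `Σ_c ‖(Q(U)A)(c) − (Q(1)A)(c)‖² ≤ 2d·(102(d+1)²L·ε_U)²·Σ_b ‖A(b)‖²`, hence `‖Q(U)f − Q(1)f‖_{L²(c₁)} ≤ M_φ′M_φ·√(2d·c₁∕c₀)·102(d+1)²L·ε_U·‖f‖_{L²(c₀)}`**
# — ne9-leaf-04's pointwise letter `B9Eq315QLipschitz.norm_QtorusLin_sub_flat_le` LOCALISED to the two blocks `B(c₋) ∪ B(c₊)` that `(Q(V)A)(c)` reads

statement-level skeleton of published theorems with citation tags; proofs where landed; nothing here is a claim about the Yang–Mills mass gap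

PDF held: `paper:balaban1985-cmp99-background-propagators` (journal page = PDF page + 388) p. 393 (text layer p0005, read by this seat 2026-08-22); p. 407 and
[Balaban1985Averaging] pp. 24, 31, 36 through the verbatim quotations of the tree's `B9Eq315QFlatNorm`, `B7Prop1Local`, `B7Prop5GeneralLevels`.
THE PRINT (verbatim).  [B9] p. 393: *«They are compositions of j one-step averaging operators Q_j(U) = Q(Ū^{j−1})…Q(U) (3.15) where Q(V) is given by the
explicit formula (124) in [5].»*; p. 407: *«… is a semi-local operator in the sense that the value (P₂(A)A′)(b) at a bond b ∈ B_j(Λ_j) depends on A, A′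
restricted to j-blocks neighbouring the block containing the bond b.»*; [B7] p. 24 (after (43)): *«this definition is local in the sense that Ū^k_c,
c ⊂ Ω^{(k)}, depends only on the bond variables U_b for b ⊂ B^k(c₋) ∪ B^k(c₊)»*, p. 31: (89)–(91) *«have the same locality properties»*.

WHY THIS FILE (cell context; OFFER O-ne9leaf02-g64-2 of the pub-balaban NE9 crux team, step (i)).  The NE9 chain reads the averaging letter `δ_Q`
(`‖Q(U)x − Q(1)x‖ ≤ δ_Q‖x‖` on the weighted `L²` carriers) off ne9-leaf-04's POINTWISE letter with a GLOBAL sup of the field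
(`norm_QtorusLin_sub_flat_le`: `‖(Q(U)A)(c) − (Q(1)A)(c)‖ ≤ 102(d+1)²L·ε_U·sup_b ‖A b‖`), and the sup→`L²` conversion (`norm_QtorusW_sub_flat_le`)
then costs `√(c₁·|𝔅(T_m)|∕c₀)` — along print's weights (3.16) (`c₁∕c₀ = L^{kd}∕(ηL^k)²` at `k` levels) that is `√|𝔅(T_{L^k m})|∕(ηL^k)`, the bond
count of the FINE torus, exponential in the number of levels.  But `(Q(V)A)(c)` is LOCAL: by the crews' `B7Prop5GeneralLevels.linQcov_congr` it reads
`A` only on the bonds of `B(c₋) ∪ B(c₊)`.  Feeding leaf-04's letter the BOX-TRUNCATED field with the local `ℓ²` mass as its sup, and counting with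
ne9-leaf-03's chart lemma `B9Eq315QFlatNorm.sum_chart_le` that every fine bond lies in at most `2d` such boxes, gives the `L²` letter with `√(2d·c₁∕c₀)`
in place of `√(c₁|𝔅(T_m)|∕c₀)` — NO VOLUME.  The tower composition (step (iii)) is the sequel `B9Eq315QTowerLipschitzL2`.

WHAT IS PROVED (sorry-free; proof lane — no `def`, no `Prop` placeholder, no inequality of the papers asserted hypothesis-free).
* §1 `inBox_decomp` — a site of the box `[q, q + (L−1)𝟙 + Le_κ]`, `q = L·y`, is `L·y + r + i·L·e_κ` with `r ∈ [0,L)^d`, `i ∈ {0,1}` (the two blocks).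
* §2 `norm_QtorusLin_sub_flat_le_of_agree` (leaf-04's letter fed any field agreeing with `Ã` on the box), `exists_truncation` (the box-truncated field,
  bounded by the local mass), **`norm_QtorusLin_sub_flat_le_local`** — `‖(Q(U)A)(c) − (Q(1)A)(c)‖ ≤ 102(d+1)²L·ε_U·√(S_c(A))` with the LOCAL mass
  `S_c(A) = Σ_{r,i,κ′} ‖A((L·c₋ + r + iLe_κ) mod Lm, κ′)‖²` over the sites of `B(c₋) ∪ B(c₊)`.
* §3 **`sum_local_mass_le`** — `Σ_c S_c(A) ≤ 2d·Σ_b ‖A b‖²` (leaf-03's `sum_chart_le` at the shifts `0`, `Le_κ`, per direction); **`sum_norm_sq_QtorusLin_sub_flat_le`**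
  — `Σ_c ‖(Q(U)A)(c) − (Q(1)A)(c)‖² ≤ 2d·(102(d+1)²L·ε_U)²·Σ_b ‖A b‖²`.
* §4 **`norm_QtorusW_sub_flat_le_local`** — on the chain's carriers: `‖Q(U)f − Q(1)f‖ ≤ M_φ′·M_φ·√(2d·c₁∕c₀)·102(d+1)²L·ε_U·‖f‖` for EVERY admissible
  set of regularity letters on either side — leaf-04's `norm_QtorusW_sub_flat_le` with `√(2d)` in place of `√|𝔅(T_m)|`.
MODEL ∕ DECLARED READINGS.  (M1) those of `B9Eq315QTorus` ∕ `B9Eq315QLipschitz`: one averaging step `T_{Lm} → T_m`, periodic readings on `ℤ^d`, `L ≥ 1`,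
the background's bond smallness `ε_U` and E162's regularity letters displayed, weights `c₀, c₁ > 0`, fibre letters `M_φ, M_φ′`.  (M2) the constant
`102(d+1)²L·√(2d)` is explicit and volume-free but NOT print's: print's (139)–(140) bound `Q″(V₀)A` by the two-block average `Q″|A|` with a constant
«depending on d and L only» — the same locality, sharper bookkeeping.
HONEST SCOPE.  [folklore] locality + Cauchy–Schwarz + an overlap count on landed theorems; nothing of [B9] Lemma 3.1 ∕ (3.37) (the gauge road to small
`ε_U`); NOT summit progress (cell pub-balaban: NE9 NOT PRINTED ∕ NOT PROVED, «NE9 ⇐ the named binders»; row WALLED ON A MODEL; spine PROVED 0∕9; rung (B)+1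
finite T⁴ — NOT infinite volume, NOT mass gap, NOT Clay; HONEST DEPENDENCY: continuum YM on T⁴ ⇐ BetaPertH ∧ nine spine estimates (0/9 proved); BetaPertH
⇐ (D1) ∧ (D4) ∧ CAP+tail; G-an2-4 gates asym, D1 and NE2/3/4).  Filed by the NE9 crux-team leaf seat `b2b-balaban-t4-ne9-formalise-leaf-02` (gen 64); NEW
file importing `B9Eq315QFlatNorm` and `B7Prop5GeneralLevels`; nothing of leaf-03's ∕ leaf-04's files modified or restated.  Net new unproved facts: 0.
-/

noncomputable section

open scoped BigOperators

namespace Literature.MathematicalPhysics.QuantumFieldTheory.Balaban1983to89.B9Eq315QLipschitzL2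

open B7Prop1Explicit (U1 Wcx boxVec e e_apply)
open B7Prop1Local (InBox AgreeOn bondHi clamp clamp_inBox clamp_of_inBox)
open B7Prop3GeneralLinear (linQcov)
open B7Prop5GeneralLevels (linQcov_congr)
open B4Sect5Torus (TSite)
open B9SectCLatticeCarrier (Bond)
open B9Eq319QprimeTorus (fineP)
open B9Eq311L2Pairing (WL2)
open B11Eq103H1Complex (BondL2K)
open B9Eq315QTorus (perSite perCfg perCfg_apply cornerSite QtorusLin QtorusLin_apply QtorusW QtorusW_apply)
open B9Eq315QLipschitz (norm_linQcov_sub_flat_le_of_bonds perCfg_const_one norm_apply_le_of_WL2)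
open B9Eq315QFlatNorm (sum_chart_le)

variable {d : ℕ}

/-! ## §1 The sites of `B(c₋) ∪ B(c₊)` -/

/-- **The box `[q, q + (L−1)𝟙 + Le_κ]` with corner `q = L·y` IS the union of the two blocks `B(y)`, `B(y + e_κ)`**: each of its sites is
`L·y + r + i·(L·e_κ)` with `r ∈ [0,L)^d`, `i ∈ {0, 1}`. [cite: Balaban1985Averaging, (2) p.17, p.24 (after (43))] -/
theorem inBox_decomp (L : ℕ) (hL : 1 ≤ L) {m : Fin d → ℕ} (y : TSite d m) (κ : Fin d) {x : B7Prop1Explicit.Site d}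
    (hx : InBox (cornerSite L y) (bondHi L (cornerSite L y) κ) x) :
    ∃ (r : Fin d → Fin L) (i : Fin 2), x = cornerSite L y + boxVec L r + (((i : ℕ) : ℤ) * (L : ℤ)) • e κ := by
  -- the offset along `κ` decides the block
  by_cases hi : x κ < cornerSite L y κ + L
  · -- block `B(y)`: `i = 0`
    refine ⟨fun j => ⟨(x j - cornerSite L y j).toNat, ?_⟩, 0, ?_⟩
    · have hj := hx j
      by_cases hjκ : j = κ
      · subst hjκ; simp only [bondHi, if_true] at hj; omega
      · simp only [bondHi, if_neg hjκ] at hj; omega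
    · funext j
      have hj := hx j
      by_cases hjκ : j = κ
      · subst hjκ
        simp only [bondHi, if_true] at hj
        simp only [Pi.add_apply, boxVec, Pi.smul_apply, e_apply, if_true, smul_eq_mul, Fin.val_zero, Nat.cast_zero, zero_mul, add_zero]
        omega
      · simp only [bondHi, if_neg hjκ] at hj
        simp only [Pi.add_apply, boxVec, Pi.smul_apply, e_apply, if_neg hjκ, smul_eq_mul, mul_zero, add_zero]
        omega
  · -- block `B(y + e_κ)`: `i = 1`
    refine ⟨fun j => ⟨(x j - cornerSite L y j - if j = κ then (L : ℤ) else 0).toNat, ?_⟩, 1, ?_⟩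
    · have hj := hx j
      by_cases hjκ : j = κ
      · subst hjκ; simp only [bondHi, if_true] at hj ⊢; omega
      · simp only [bondHi, if_neg hjκ] at hj ⊢; omega
    · funext j
      have hj := hx j
      by_cases hjκ : j = κ
      · subst hjκ
        simp only [bondHi, if_true] at hj
        simp only [Pi.add_apply, boxVec, Pi.smul_apply, e_apply, if_true, smul_eq_mul, Fin.val_one, Nat.cast_one, one_mul, mul_one]
        omega
      · simp only [bondHi, if_neg hjκ] at hj
        simp only [Pi.add_apply, boxVec, Pi.smul_apply, e_apply, if_neg hjκ, smul_eq_mul, mul_zero, add_zero]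
        omega

/-! ## §2 The pointwise letter with the LOCAL mass of the field -/

section Local

variable {𝔸 : Type*} [NormedRing 𝔸] [NormOneClass 𝔸] [NormedAlgebra ℂ 𝔸] [CompleteSpace 𝔸] (L : ℕ) (m : Fin d → ℕ) [∀ i, NeZero (fineP L m i)]
  (hL : 1 ≤ L) (U : Bond d (fineP L m) → 𝔸ˣ) {α : ℝ} (hα1 : α ≤ 1 / 64)
  (hU1 : ∀ (x : B7Prop1Explicit.Site d) (κ : Fin d), perCfg (fineP L m) U x κ ∈ U1 𝔸)
  (hreg : ∀ (y : TSite d m) (κ : Fin d) (r : Fin d → Fin L),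
    ‖((Wcx L (perCfg (fineP L m) U) (cornerSite L y) κ (boxVec L r) : 𝔸ˣ) : 𝔸) - 1‖ ≤ α)
  {α' : ℝ} (hα1' : α' ≤ 1 / 64)
  (hU1' : ∀ (x : B7Prop1Explicit.Site d) (κ : Fin d), perCfg (fineP L m) (fun _ : Bond d (fineP L m) => (1 : 𝔸ˣ)) x κ ∈ U1 𝔸)
  (hreg' : ∀ (y : TSite d m) (κ : Fin d) (r : Fin d → Fin L),
    ‖((Wcx L (perCfg (fineP L m) (fun _ : Bond d (fineP L m) => (1 : 𝔸ˣ))) (cornerSite L y) κ (boxVec L r) : 𝔸ˣ) : 𝔸) - 1‖ ≤ α')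
  {εU : ℝ} (hεU : 0 ≤ εU) (hUε : ∀ b : Bond d (fineP L m), ‖(U b : 𝔸) - 1‖ ≤ εU)

include hεU hUε in
/-- **LOCALITY FED TO LEAF-04's LETTER**: if a field `T` on `ℤ^d` agrees with the periodic extension of `A` on the bonds of `B(c₋) ∪ B(c₊)` and is
bounded by `a`, then `‖(Q(U)A)(c) − (Q(1)A)(c)‖ ≤ 102(d+1)²L·ε_U·a` — `(Q(V)A)(c)` reads `A` only on that box (`B7Prop5GeneralLevels.linQcov_congr`).
[cite: Balaban1985BackgroundPropagators, (3.15) p.393, (3.78)–(3.79) p.406, p.407; Balaban1985Averaging, (124)–(126) p.36, p.24, p.31] -/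
theorem norm_QtorusLin_sub_flat_le_of_agree (A : Bond d (fineP L m) → 𝔸) (c : Bond d m) (T : B7Prop1Explicit.Site d → Fin d → 𝔸) {a : ℝ}
    (ha : 0 ≤ a) (hT : ∀ (x : B7Prop1Explicit.Site d) (κ' : Fin d), ‖T x κ'‖ ≤ a)
    (hagree : AgreeOn (cornerSite L c.1) (bondHi L (cornerSite L c.1) c.2) (perCfg (fineP L m) A) T) :
    ‖QtorusLin L m hL U hα1 hU1 hreg A c - QtorusLin L m hL (fun _ => 1) hα1' hU1' hreg' A c‖ ≤ 102 * (d + 1) ^ 2 * L * εU * a := by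
  have hLpos : (0 : ℝ) < L := by exact_mod_cast hL
  have hUp : ∀ (x : B7Prop1Explicit.Site d) (κ' : Fin d), ‖((perCfg (fineP L m) U x κ' : 𝔸ˣ) : 𝔸) - 1‖ ≤ εU := fun x κ' => hUε _
  have hloc : ∀ (V : B7Prop1Explicit.Site d → Fin d → 𝔸ˣ),
      linQcov L V (perCfg (fineP L m) A) (cornerSite L c.1) c.2 = linQcov L V T (cornerSite L c.1) c.2 :=
    fun V => linQcov_congr L hL (cornerSite L c.1) c.2 (fun _ _ _ _ => rfl) hagree
  have h := norm_linQcov_sub_flat_le_of_bonds L hU1 hUp ha hT hL (cornerSite L c.1) c.2 hα1 (hreg c.1 c.2) hεU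
  rw [QtorusLin_apply, QtorusLin_apply, ← smul_sub, norm_smul, norm_inv, Complex.norm_natCast, perCfg_const_one, hloc, hloc,
    inv_mul_le_iff₀ hLpos]
  exact h.trans (le_of_eq (by ring))

omit [NormOneClass 𝔸] [NormedAlgebra ℂ 𝔸] [CompleteSpace 𝔸] in
include hL in
/-- **The box-clamped field**: there is a field on `ℤ^d` agreeing with `Ã` on the bonds of `B(c₋) ∪ B(c₊)` and bounded EVERYWHERE by the local mass
`√S_c(A)`, `S_c(A) = Σ_{r,i,κ′} ‖A((L·c₋ + r + iLe_κ) mod Lm, κ′)‖²` — `Ã` read at the box-clamped site (`B7Prop1Local.clamp`; each box site is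
`L·c₋ + r + iLe_κ`, §1). [cite: Balaban1985Averaging, (1)–(2) p.17, p.24; Balaban1985BackgroundPropagators, p.407] -/
theorem exists_truncation (A : Bond d (fineP L m) → 𝔸) (c : Bond d m) :
    ∃ T : B7Prop1Explicit.Site d → Fin d → 𝔸,
      AgreeOn (cornerSite L c.1) (bondHi L (cornerSite L c.1) c.2) (perCfg (fineP L m) A) T ∧
      ∀ (x : B7Prop1Explicit.Site d) (κ' : Fin d), ‖T x κ'‖ ≤
        Real.sqrt (∑ r : Fin d → Fin L, ∑ i : Fin 2, ∑ κ'' : Fin d,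
          ‖A (perSite (fineP L m) (cornerSite L c.1 + boxVec L r + (((i : ℕ) : ℤ) * (L : ℤ)) • e c.2), κ'')‖ ^ 2) := by
  have hlohi : ∀ i, cornerSite L c.1 i ≤ bondHi L (cornerSite L c.1) c.2 i := fun i => by
    simp only [bondHi]; split_ifs <;> omega
  refine ⟨fun x κ' => perCfg (fineP L m) A (clamp (cornerSite L c.1) (bondHi L (cornerSite L c.1) c.2) x) κ',
    fun x κ' hx _ => by simp only [clamp_of_inBox hx], fun x κ' => ?_⟩
  obtain ⟨r, i, hxe⟩ := inBox_decomp L hL c.1 c.2 (clamp_inBox hlohi x)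
  refine Real.le_sqrt_of_sq_le ?_
  dsimp only
  rw [perCfg_apply, hxe]
  -- one term of a triple sum of squares
  calc ‖A (perSite (fineP L m) (cornerSite L c.1 + boxVec L r + (((i : ℕ) : ℤ) * (L : ℤ)) • e c.2), κ')‖ ^ 2
      ≤ ∑ κ'' : Fin d, ‖A (perSite (fineP L m) (cornerSite L c.1 + boxVec L r + (((i : ℕ) : ℤ) * (L : ℤ)) • e c.2), κ'')‖ ^ 2 :=
        Finset.single_le_sum
          (f := fun κ'' : Fin d => ‖A (perSite (fineP L m) (cornerSite L c.1 + boxVec L r + (((i : ℕ) : ℤ) * (L : ℤ)) • e c.2), κ'')‖ ^ 2)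
          (fun _ _ => by positivity) (Finset.mem_univ κ')
    _ ≤ ∑ i' : Fin 2, ∑ κ'' : Fin d, ‖A (perSite (fineP L m) (cornerSite L c.1 + boxVec L r + (((i' : ℕ) : ℤ) * (L : ℤ)) • e c.2), κ'')‖ ^ 2 :=
        Finset.single_le_sum
          (f := fun i' : Fin 2 => ∑ κ'' : Fin d, ‖A (perSite (fineP L m) (cornerSite L c.1 + boxVec L r + (((i' : ℕ) : ℤ) * (L : ℤ)) • e c.2), κ'')‖ ^ 2)
          (fun _ _ => by positivity) (Finset.mem_univ i)
    _ ≤ ∑ r' : Fin d → Fin L, ∑ i' : Fin 2, ∑ κ'' : Fin d,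
          ‖A (perSite (fineP L m) (cornerSite L c.1 + boxVec L r' + (((i' : ℕ) : ℤ) * (L : ℤ)) • e c.2), κ'')‖ ^ 2 :=
        Finset.single_le_sum
          (f := fun r' : Fin d → Fin L => ∑ i' : Fin 2, ∑ κ'' : Fin d,
            ‖A (perSite (fineP L m) (cornerSite L c.1 + boxVec L r' + (((i' : ℕ) : ℤ) * (L : ℤ)) • e c.2), κ'')‖ ^ 2)
          (fun _ _ => by positivity) (Finset.mem_univ r)

include hεU hUε in
/-- **THE POINTWISE `δ_Q`-LETTER WITH THE LOCAL MASS**: `‖(Q(U)A)(c) − (Q(1)A)(c)‖ ≤ 102(d+1)²L·ε_U·√(S_c(A))`, where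
`S_c(A) = Σ_{r∈[0,L)^d} Σ_{i∈{0,1}} Σ_{κ′} ‖A((L·c₋ + r + iLe_κ) mod Lm, κ′)‖²` is the `ℓ²`-mass of `A` over the sites of the two blocks `B(c₋) ∪ B(c₊)`.
[cite: Balaban1985BackgroundPropagators, (3.15) p.393, (3.78)–(3.79) p.406, p.407; Balaban1985Averaging, (124)–(126) p.36, p.24, p.31] -/
theorem norm_QtorusLin_sub_flat_le_local (A : Bond d (fineP L m) → 𝔸) (c : Bond d m) :
    ‖QtorusLin L m hL U hα1 hU1 hreg A c - QtorusLin L m hL (fun _ => 1) hα1' hU1' hreg' A c‖ ≤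
      102 * (d + 1) ^ 2 * L * εU *
        Real.sqrt (∑ r : Fin d → Fin L, ∑ i : Fin 2, ∑ κ' : Fin d,
          ‖A (perSite (fineP L m) (cornerSite L c.1 + boxVec L r + (((i : ℕ) : ℤ) * (L : ℤ)) • e c.2), κ')‖ ^ 2) := by
  obtain ⟨T, hagree, hT⟩ := exists_truncation L m hL A c
  exact norm_QtorusLin_sub_flat_le_of_agree L m hL U hα1 hU1 hreg hα1' hU1' hreg' hεU hUε A c T (Real.sqrt_nonneg _) hT hagree

/-! ## §3 The overlap count: every fine bond lies in at most `2d` of the boxes -/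

omit [NormOneClass 𝔸] [NormedAlgebra ℂ 𝔸] [CompleteSpace 𝔸] in
/-- **`Σ_c S_c(A) ≤ 2d·Σ_b ‖A b‖²`** — for each direction `κ` and each of the two shifts `0`, `L·e_κ` the block chart `(y, r) ↦ (L·y + r + v) mod Lm`
is injective (ne9-leaf-03's `B9Eq315QFlatNorm.sum_chart_le`), so each of the `2d` partial sums is at most the full `ℓ²` mass.
[cite: Balaban1985Averaging, (1)–(2) p.17, p.24; Balaban1985BackgroundPropagators, p.407] -/
theorem sum_local_mass_le [NeZero L] (A : Bond d (fineP L m) → 𝔸) :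
    ∑ c : Bond d m, ∑ r : Fin d → Fin L, ∑ i : Fin 2, ∑ κ' : Fin d,
        ‖A (perSite (fineP L m) (cornerSite L c.1 + boxVec L r + (((i : ℕ) : ℤ) * (L : ℤ)) • e c.2), κ')‖ ^ 2 ≤
      2 * d * ∑ b : Bond d (fineP L m), ‖A b‖ ^ 2 := by
  classical
  -- the summand as a function of (coarse site, box offset, block index, coarse direction, fine direction)
  set F : TSite d m → (Fin d → Fin L) → Fin 2 → Fin d → Fin d → ℝ := fun y r i κ κ' =>
    ‖A (perSite (fineP L m) (cornerSite L y + boxVec L r + (((i : ℕ) : ℤ) * (L : ℤ)) • e κ), κ')‖ ^ 2 with hF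
  have hF0 : ∀ y r i κ κ', 0 ≤ F y r i κ κ' := fun _ _ _ _ _ => by rw [hF]; positivity
  -- each chart sum is at most the full mass in the fine direction `κ′` (leaf-03's injective block chart at the shift `iL·e_κ`)
  have hch : ∀ (κ : Fin d) (i : Fin 2) (κ' : Fin d),
      ∑ p : TSite d m × (Fin d → Fin L), F p.1 p.2 i κ κ' ≤ ∑ s : TSite d (fineP L m), ‖A (s, κ')‖ ^ 2 :=
    fun κ i κ' => sum_chart_le L m ((((i : ℕ) : ℤ) * (L : ℤ)) • e κ) (g := fun s => ‖A (s, κ')‖ ^ 2) fun _ => by positivity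
  have hbond : ∑ κ' : Fin d, ∑ s : TSite d (fineP L m), ‖A (s, κ')‖ ^ 2 = ∑ b : Bond d (fineP L m), ‖A b‖ ^ 2 := by
    rw [Fintype.sum_prod_type, Finset.sum_comm]
  -- regroup the left-hand side: `Σ_{(y,κ)} Σ_r Σ_i Σ_κ′ = Σ_κ Σ_i Σ_κ′ Σ_{(y,r)}`
  have h2 : ∀ κ : Fin d, ∑ i : Fin 2, ∑ κ' : Fin d, ∑ p : TSite d m × (Fin d → Fin L), F p.1 p.2 i κ κ' =
      ∑ y : TSite d m, ∑ r : Fin d → Fin L, ∑ i : Fin 2, ∑ κ' : Fin d, F y r i κ κ' := by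
    intro κ
    have h3 : ∀ (i : Fin 2) (κ' : Fin d), ∑ p : TSite d m × (Fin d → Fin L), F p.1 p.2 i κ κ' =
        ∑ y : TSite d m, ∑ r : Fin d → Fin L, F y r i κ κ' :=
      fun i κ' => Fintype.sum_prod_type (fun p : TSite d m × (Fin d → Fin L) => F p.1 p.2 i κ κ')
    simp_rw [h3]
    calc ∑ i : Fin 2, ∑ κ' : Fin d, ∑ y : TSite d m, ∑ r : Fin d → Fin L, F y r i κ κ'
        = ∑ i : Fin 2, ∑ y : TSite d m, ∑ κ' : Fin d, ∑ r : Fin d → Fin L, F y r i κ κ' :=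
          Finset.sum_congr rfl fun i _ => Finset.sum_comm
      _ = ∑ y : TSite d m, ∑ i : Fin 2, ∑ κ' : Fin d, ∑ r : Fin d → Fin L, F y r i κ κ' := Finset.sum_comm
      _ = ∑ y : TSite d m, ∑ i : Fin 2, ∑ r : Fin d → Fin L, ∑ κ' : Fin d, F y r i κ κ' :=
          Finset.sum_congr rfl fun y _ => Finset.sum_congr rfl fun i _ => Finset.sum_comm
      _ = ∑ y : TSite d m, ∑ r : Fin d → Fin L, ∑ i : Fin 2, ∑ κ' : Fin d, F y r i κ κ' :=
          Finset.sum_congr rfl fun y _ => Finset.sum_comm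
  have hre : ∑ c : Bond d m, ∑ r : Fin d → Fin L, ∑ i : Fin 2, ∑ κ' : Fin d, F c.1 r i c.2 κ' =
      ∑ κ : Fin d, ∑ i : Fin 2, ∑ κ' : Fin d, ∑ p : TSite d m × (Fin d → Fin L), F p.1 p.2 i κ κ' :=
    calc ∑ c : Bond d m, ∑ r : Fin d → Fin L, ∑ i : Fin 2, ∑ κ' : Fin d, F c.1 r i c.2 κ'
        = ∑ y : TSite d m, ∑ κ : Fin d, ∑ r : Fin d → Fin L, ∑ i : Fin 2, ∑ κ' : Fin d, F y r i κ κ' :=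
          Fintype.sum_prod_type (fun c : Bond d m => ∑ r : Fin d → Fin L, ∑ i : Fin 2, ∑ κ' : Fin d, F c.1 r i c.2 κ')
      _ = ∑ κ : Fin d, ∑ y : TSite d m, ∑ r : Fin d → Fin L, ∑ i : Fin 2, ∑ κ' : Fin d, F y r i κ κ' := Finset.sum_comm
      _ = ∑ κ : Fin d, ∑ i : Fin 2, ∑ κ' : Fin d, ∑ p : TSite d m × (Fin d → Fin L), F p.1 p.2 i κ κ' :=
          Finset.sum_congr rfl fun κ _ => (h2 κ).symm
  have hre' : ∑ c : Bond d m, ∑ r : Fin d → Fin L, ∑ i : Fin 2, ∑ κ' : Fin d,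
        ‖A (perSite (fineP L m) (cornerSite L c.1 + boxVec L r + (((i : ℕ) : ℤ) * (L : ℤ)) • e c.2), κ')‖ ^ 2 =
      ∑ c : Bond d m, ∑ r : Fin d → Fin L, ∑ i : Fin 2, ∑ κ' : Fin d, F c.1 r i c.2 κ' := by simp only [hF]
  rw [hre', hre]
  calc ∑ κ : Fin d, ∑ i : Fin 2, ∑ κ' : Fin d, ∑ p : TSite d m × (Fin d → Fin L), F p.1 p.2 i κ κ'
      ≤ ∑ _κ : Fin d, ∑ _i : Fin 2, ∑ κ' : Fin d, ∑ s : TSite d (fineP L m), ‖A (s, κ')‖ ^ 2 := by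
        gcongr with κ _ i _ κ' _
        exact hch κ i κ'
    _ = 2 * d * ∑ b : Bond d (fineP L m), ‖A b‖ ^ 2 := by
        rw [hbond]; simp only [Finset.sum_const, Finset.card_univ, Fintype.card_fin]; ring

include hεU hUε in
/-- **THE ONE-STEP `δ_Q`-LETTER, `ℓ²` FORM, VOLUME-FREE**: `Σ_c ‖(Q(U)A)(c) − (Q(1)A)(c)‖² ≤ 2d·(102(d+1)²L·ε_U)²·Σ_b ‖A b‖²` (§2 squared and summed, §3).
[cite: Balaban1985BackgroundPropagators, (3.15) p.393, (3.78)–(3.79) p.406, p.407; Balaban1985Averaging, (124)–(126) p.36, p.24] -/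
theorem sum_norm_sq_QtorusLin_sub_flat_le [NeZero L] (A : Bond d (fineP L m) → 𝔸) :
    ∑ c : Bond d m, ‖QtorusLin L m hL U hα1 hU1 hreg A c - QtorusLin L m hL (fun _ => 1) hα1' hU1' hreg' A c‖ ^ 2 ≤
      2 * d * (102 * (d + 1) ^ 2 * L * εU) ^ 2 * ∑ b : Bond d (fineP L m), ‖A b‖ ^ 2 := by
  have hC : 0 ≤ 102 * ((d : ℝ) + 1) ^ 2 * L * εU := by positivity
  calc ∑ c : Bond d m, ‖QtorusLin L m hL U hα1 hU1 hreg A c - QtorusLin L m hL (fun _ => 1) hα1' hU1' hreg' A c‖ ^ 2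
      ≤ ∑ c : Bond d m, (102 * (d + 1) ^ 2 * L * εU) ^ 2 * ∑ r : Fin d → Fin L, ∑ i : Fin 2, ∑ κ' : Fin d,
          ‖A (perSite (fineP L m) (cornerSite L c.1 + boxVec L r + (((i : ℕ) : ℤ) * (L : ℤ)) • e c.2), κ')‖ ^ 2 := by
        refine Finset.sum_le_sum fun c _ => ?_
        have h := norm_QtorusLin_sub_flat_le_local L m hL U hα1 hU1 hreg hα1' hU1' hreg' hεU hUε A c
        have hS0 : 0 ≤ ∑ r : Fin d → Fin L, ∑ i : Fin 2, ∑ κ' : Fin d,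
            ‖A (perSite (fineP L m) (cornerSite L c.1 + boxVec L r + (((i : ℕ) : ℤ) * (L : ℤ)) • e c.2), κ')‖ ^ 2 := by positivity
        calc _ ≤ (102 * (d + 1) ^ 2 * L * εU * Real.sqrt (∑ r : Fin d → Fin L, ∑ i : Fin 2, ∑ κ' : Fin d,
              ‖A (perSite (fineP L m) (cornerSite L c.1 + boxVec L r + (((i : ℕ) : ℤ) * (L : ℤ)) • e c.2), κ')‖ ^ 2)) ^ 2 :=
              pow_le_pow_left₀ (norm_nonneg _) h 2
          _ = _ := by rw [mul_pow, Real.sq_sqrt hS0]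
    _ = (102 * (d + 1) ^ 2 * L * εU) ^ 2 * ∑ c : Bond d m, ∑ r : Fin d → Fin L, ∑ i : Fin 2, ∑ κ' : Fin d,
          ‖A (perSite (fineP L m) (cornerSite L c.1 + boxVec L r + (((i : ℕ) : ℤ) * (L : ℤ)) • e c.2), κ')‖ ^ 2 := by
        rw [Finset.mul_sum]
    _ ≤ (102 * (d + 1) ^ 2 * L * εU) ^ 2 * (2 * d * ∑ b : Bond d (fineP L m), ‖A b‖ ^ 2) :=
        mul_le_mul_of_nonneg_left (sum_local_mass_le L m A) (by positivity)
    _ = 2 * d * (102 * (d + 1) ^ 2 * L * εU) ^ 2 * ∑ b : Bond d (fineP L m), ‖A b‖ ^ 2 := by ring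

/-! ## §4 On the chain's weighted `L²` carriers -/

variable {W : Type*} [NormedAddCommGroup W] [InnerProductSpace ℂ W] (φ : W ≃ₗ[ℂ] 𝔸) {c₀ c₁ : ℝ} [Fact (0 < c₀)] [Fact (0 < c₁)]
  {Mφ Mφ' : ℝ} (hMφ : 0 ≤ Mφ) (hφ : ∀ w, ‖φ w‖ ≤ Mφ * ‖w‖) (hMφ' : 0 ≤ Mφ') (hφ' : ∀ X, ‖φ.symm X‖ ≤ Mφ' * ‖X‖)

include hεU hUε hMφ hφ hMφ' hφ' in
/-- **THE `δ_Q`-LETTER ON THE NE9 CHAIN's CARRIERS WITHOUT THE VOLUME**: `‖Q(U)f − Q(1)f‖_{L²(c₁)} ≤ M_φ′·M_φ·√(2d·c₁∕c₀)·102(d+1)²L·ε_U·‖f‖_{L²(c₀)}` for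
EVERY admissible set of regularity letters on either side — ne9-leaf-04's `B9Eq315QLipschitz.norm_QtorusW_sub_flat_le` with `√(2d)` in place of
`√|𝔅(T_m)|`.  Along (3.16)'s one-level weights `c₁ = c₀L^d` the constant is `M_φ′M_φ·√(2d·L^d)·102(d+1)²L·ε_U`, free of `m`.
[cite: Balaban1985BackgroundPropagators, (3.15)–(3.16) p.393, (3.78)–(3.79) p.406, (3.82) p.407; Balaban1985Averaging, (124)–(126) p.36] -/
theorem norm_QtorusW_sub_flat_le_local [NeZero L] (f : BondL2K ℂ d (fineP L m) c₀ W) :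
    ‖QtorusW L m hL φ U hα1 hU1 hreg (c₁ := c₁) f - QtorusW L m hL φ (fun _ => 1) hα1' hU1' hreg' (c₁ := c₁) f‖ ≤
      Mφ' * Mφ * Real.sqrt (2 * d * c₁ / c₀) * (102 * (d + 1) ^ 2 * L * εU) * ‖f‖ := by
  have hc₀ : 0 < c₀ := Fact.out
  have hc₁ : 0 < c₁ := Fact.out
  set g : Bond d (fineP L m) → 𝔸 := fun b => φ (WL2.equiv ℂ (fun _ : Bond d (fineP L m) => c₀) W f b) with hg
  -- the fine side: `Σ_b ‖g b‖² ≤ M_φ²·c₀⁻¹·‖f‖²`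
  have hn : ‖f‖ ^ 2 = ∑ b, c₀ * ‖WL2.equiv ℂ (fun _ : Bond d (fineP L m) => c₀) W f b‖ ^ 2 :=
    WL2.norm_sq (𝕜 := ℂ) (w := fun _ : Bond d (fineP L m) => c₀) (V := W) f
  have hfine : ∑ b, ‖g b‖ ^ 2 ≤ Mφ ^ 2 * (c₀⁻¹ * ‖f‖ ^ 2) := by
    rw [hn, Finset.mul_sum, Finset.mul_sum]
    refine Finset.sum_le_sum fun b _ => ?_
    have h1 : ‖g b‖ ^ 2 ≤ (Mφ * ‖WL2.equiv ℂ (fun _ : Bond d (fineP L m) => c₀) W f b‖) ^ 2 :=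
      pow_le_pow_left₀ (norm_nonneg _) (hφ _) 2
    refine h1.trans (le_of_eq ?_)
    field_simp
  -- the coarse side, pointwise through `φ⁻¹`
  have hpt : ∀ c : Bond d m, ‖WL2.equiv ℂ (fun _ : Bond d m => c₁) W (QtorusW L m hL φ U hα1 hU1 hreg (c₁ := c₁) f -
        QtorusW L m hL φ (fun _ => 1) hα1' hU1' hreg' (c₁ := c₁) f) c‖ ^ 2 ≤
      Mφ' ^ 2 * ‖QtorusLin L m hL U hα1 hU1 hreg g c - QtorusLin L m hL (fun _ => 1) hα1' hU1' hreg' g c‖ ^ 2 := fun c => by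
    rw [WL2.equiv_sub, Pi.sub_apply, QtorusW_apply, QtorusW_apply, ← map_sub, ← mul_pow]
    exact pow_le_pow_left₀ (norm_nonneg _) (hφ' _) 2
  set C : ℝ := 102 * (d + 1) ^ 2 * L * εU with hC
  have hC0 : 0 ≤ C := by rw [hC]; positivity
  have hsq : ‖QtorusW L m hL φ U hα1 hU1 hreg (c₁ := c₁) f - QtorusW L m hL φ (fun _ => 1) hα1' hU1' hreg' (c₁ := c₁) f‖ ^ 2 ≤
      (Mφ' * Mφ * Real.sqrt (2 * d * c₁ / c₀) * C * ‖f‖) ^ 2 :=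
    calc ‖QtorusW L m hL φ U hα1 hU1 hreg (c₁ := c₁) f - QtorusW L m hL φ (fun _ => 1) hα1' hU1' hreg' (c₁ := c₁) f‖ ^ 2
        = ∑ c, c₁ * ‖WL2.equiv ℂ (fun _ : Bond d m => c₁) W (QtorusW L m hL φ U hα1 hU1 hreg (c₁ := c₁) f -
            QtorusW L m hL φ (fun _ => 1) hα1' hU1' hreg' (c₁ := c₁) f) c‖ ^ 2 :=
          WL2.norm_sq (𝕜 := ℂ) (w := fun _ : Bond d m => c₁) (V := W) _
      _ ≤ ∑ c, c₁ * (Mφ' ^ 2 * ‖QtorusLin L m hL U hα1 hU1 hreg g c - QtorusLin L m hL (fun _ => 1) hα1' hU1' hreg' g c‖ ^ 2) :=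
          Finset.sum_le_sum fun c _ => mul_le_mul_of_nonneg_left (hpt c) hc₁.le
      _ = c₁ * Mφ' ^ 2 * ∑ c, ‖QtorusLin L m hL U hα1 hU1 hreg g c - QtorusLin L m hL (fun _ => 1) hα1' hU1' hreg' g c‖ ^ 2 := by
          rw [Finset.mul_sum]; exact Finset.sum_congr rfl fun c _ => by ring
      _ ≤ c₁ * Mφ' ^ 2 * (2 * d * C ^ 2 * ∑ b, ‖g b‖ ^ 2) :=
          mul_le_mul_of_nonneg_left (sum_norm_sq_QtorusLin_sub_flat_le L m hL U hα1 hU1 hreg hα1' hU1' hreg' hεU hUε g) (by positivity)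
      _ ≤ c₁ * Mφ' ^ 2 * (2 * d * C ^ 2 * (Mφ ^ 2 * (c₀⁻¹ * ‖f‖ ^ 2))) := by gcongr
      _ = (Mφ' * Mφ * Real.sqrt (2 * d * c₁ / c₀) * C * ‖f‖) ^ 2 := by
          rw [show (Mφ' * Mφ * Real.sqrt (2 * d * c₁ / c₀) * C * ‖f‖) ^ 2 =
              Mφ' ^ 2 * Mφ ^ 2 * (Real.sqrt (2 * d * c₁ / c₀)) ^ 2 * C ^ 2 * ‖f‖ ^ 2 by ring,
            Real.sq_sqrt (by positivity : (0 : ℝ) ≤ 2 * d * c₁ / c₀)]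
          field_simp
  exact (pow_le_pow_iff_left₀ (norm_nonneg _) (by positivity) two_ne_zero).1 hsq

end Local

end Literature.MathematicalPhysics.QuantumFieldTheory.Balaban1983to89.B9Eq315QLipschitzL2

end
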